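import Literature.AlgebraicTopology.SingularHomology.SubsetCochainsPullback
import HarnessLib

/-!
# The cohomology of subsets computed in `C(X)` is invariant under embeddings of the ambient space

Topic `Literature/AlgebraicTopology/SingularHomology`. A. Hatcher, *Algebraic Topology* (2002),
§2.1 p. 111 ("a homeomorphism induces an isomorphism": singular chains only see the space through
its continuous maps from simplices) and §3.1 p. 199.  For an EMBEDDING `j : X' → X` and a subset
`W ⊆ j(X')`, every singular simplex of `X` with image in `W` factors uniquely through `j`, so

* `subsetCochains.pushChains R j _ : C_{X'}(j⁻¹W) → C_X(W)` is an isomorphism of chain complexes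
  (`isIso_pushChains_of_isEmbedding`), hence
* **`j* : H^*_X(W) → H^*_{X'}(j⁻¹W)` is bijective** (`pullH_bijective_of_isEmbedding`).

This is the change-of-ambient-space step of the Leray–Hirsch argument in the model `H^*_X(W)`
(Husemoller, *Fibre Bundles*, Ch. 17 §1, proof of Thm. 1.1: over a trivialising open set the total
space is replaced by the product `U × F` through the local trivialisation, an open embedding).

Everything is proved; no named facts.

## References

* [HatcherAT2002] A. Hatcher, *Algebraic Topology*, CUP 2002, §2.1 p. 111, §3.1 p. 199.
* [HusemollerFibreBundles1994] D. Husemoller, *Fibre Bundles*, 3rd ed. (1994), Ch. 17 §1 Thm. 1.1.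
-/

noncomputable section

open CategoryTheory Limits Topology

universe u v

namespace Literature.AlgebraicTopology.SingularHomology

namespace SingularSimplex

variable {X X' : Type u} [TopologicalSpace X] [TopologicalSpace X'] {j : C(X', X)} {n : ℕ}

/-- **Lift of a singular simplex through an embedding**: a simplex of `X` with image in `j(X')`
as a simplex of `X'`. [cite: HatcherAT2002, §2.1 p. 111] -/
def liftEmb (hj : IsEmbedding j) (τ : SingularSimplex X n) (hτ : τ.range ⊆ Set.range j) :
    SingularSimplex X' n :=
  toContinuousMap.symm
    ((⟨fun y ↦ hj.toHomeomorph.symm y, hj.toHomeomorph.symm.continuous⟩ : C(Set.range j, X')).comp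
      ⟨Set.codRestrict (toContinuousMap τ) (Set.range j) fun t ↦ hτ ⟨t, rfl⟩,
        (toContinuousMap τ).continuous.codRestrict _⟩)

/-- The lift composed with `j` is the original simplex. [folklore] -/
theorem map_liftEmb (hj : IsEmbedding j) (τ : SingularSimplex X n) (hτ : τ.range ⊆ Set.range j) :
    (τ.liftEmb hj hτ).map j = τ := by
  apply toContinuousMap_injective
  rw [toContinuousMap_map, liftEmb, Equiv.apply_symm_apply]
  ext t
  change j (hj.toHomeomorph.symm ⟨toContinuousMap τ t, hτ ⟨t, rfl⟩⟩) = toContinuousMap τ t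
  have h := hj.toHomeomorph.apply_symm_apply ⟨toContinuousMap τ t, hτ ⟨t, rfl⟩⟩
  have h' := congrArg Subtype.val h
  rwa [Topology.IsEmbedding.toHomeomorph_apply_coe] at h'

/-- A simplex in the image of push-forward along `j` has image in `j(X')`. [folklore] -/
theorem range_map_subset_range (σ : SingularSimplex X' n) : (σ.map j).range ⊆ Set.range j := by
  rw [range_map]
  exact Set.image_subset_range _ _

end SingularSimplex

namespace subsetCochains

variable (R : Type v) [CommRing R] (N : ModuleCat.{max u v} R) {X X' : Type u}
  [TopologicalSpace X] [TopologicalSpace X'] (j : C(X', X))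

/-- **For an embedding `j` and `W ⊆ j(X')`, `C_{X'}(j⁻¹W) → C_X(W)` is an isomorphism of chain
complexes** (simplices in `W` factor uniquely through `j`). [cite: HatcherAT2002, §2.1 p. 111] -/
theorem isIso_pushChains_of_isEmbedding (hj : IsEmbedding j) {W : Set X} (hW : W ⊆ Set.range j) :
    IsIso (pushChains R j (mapsTo_preimage_left j W)) := by
  classical
  refine Subcomplex.isIso_lift _ _ _ (fun i ↦ ?_) (fun i y hy ↦ ?_)
  · -- injective: `mapDomain` along the injective `σ ↦ j ∘ σ`, on a subtype
    intro x x' h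
    apply Subtype.ext
    have h' : Finsupp.mapDomain (fun σ : SingularSimplex X' i ↦ σ.map j) x.1 =
        Finsupp.mapDomain (fun σ : SingularSimplex X' i ↦ σ.map j) x'.1 := h
    exact Finsupp.mapDomain_injective (SingularSimplex.map_injective hj.injective) h'
  · -- surjective onto the chains in `W`: induct over the support
    change y ∈ chainsIn R R X W i at hy
    have key : ∀ c ∈ chainsIn R R X W i, ∃ x : (chainsInSub R R X' (j ⁻¹' W)).toComplex.X i,
        ((chainsInSub R R X' (j ⁻¹' W)).ι ≫ csingularChainComplex.map R R j).f i x = c := by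
      intro c hc
      rw [chainsIn, Finsupp.supported_eq_span_single] at hc
      refine Submodule.span_induction ?_ ⟨0, by rw [map_zero]; rfl⟩ ?_ ?_ hc
      · rintro _ ⟨τ, hτ, rfl⟩
        have hτ' : τ.range ⊆ W := (mem_simplicesIn τ).1 hτ
        have hmem : Finsupp.single (τ.liftEmb hj (hτ'.trans hW)) (1 : R) ∈ chainsIn R R X' (j ⁻¹' W) i := by
          rw [mem_chainsIn_iff]
          intro σ hσ
          obtain ⟨rfl, -⟩ := Finsupp.mem_support_single _ _ _ |>.1 hσ
          intro x hx
          change j x ∈ W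
          have : j x ∈ ((τ.liftEmb hj (hτ'.trans hW)).map j).range := by
            rw [SingularSimplex.range_map]
            exact ⟨x, hx, rfl⟩
          rw [SingularSimplex.map_liftEmb] at this
          exact hτ' this
        refine ⟨⟨Finsupp.single (τ.liftEmb hj (hτ'.trans hW)) 1, hmem⟩, ?_⟩
        change (csingularChainComplex.map R R j).f i (Finsupp.single _ 1) = Finsupp.single τ 1
        rw [csingularChainComplex.map_f_single, SingularSimplex.map_liftEmb]
      · rintro c c' - - ⟨x, hx⟩ ⟨x', hx'⟩
        exact ⟨x + x', by rw [map_add, hx, hx']; rfl⟩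
      · rintro r c - ⟨x, hx⟩
        exact ⟨r • x, by rw [map_smul, hx]; rfl⟩
    exact key y hy

/-- **The pull-back along an embedding is bijective on the cohomology of subsets of its image**:
`j* : H^p_X(W) ≅ H^p_{X'}(j⁻¹W)` for `W ⊆ j(X')` (Hatcher 2002, §2.1 p. 111; the
change-of-ambient-space step in Husemoller's proof of the Leray–Hirsch theorem).
[cite: HatcherAT2002, §2.1 p. 111] -/
theorem pullH_bijective_of_isEmbedding (hj : IsEmbedding j) {W : Set X} (hW : W ⊆ Set.range j) (p : ℕ) :
    Function.Bijective (pullH (N := N) j (mapsTo_preimage_left j W) p) := by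
  haveI := isIso_pushChains_of_isEmbedding R j hj hW
  haveI : IsIso (pull R N j (mapsTo_preimage_left j W)) := isIso_dualMap (N := N) _
  exact (ConcreteCategory.isIso_iff_bijective _).1
    (inferInstance : IsIso (HomologicalComplex.homologyMap (pull R N j (mapsTo_preimage_left j W)) p))

end subsetCochains

end Literature.AlgebraicTopology.SingularHomology
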